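import Summits.QuantumFields.BalabanUV.T4Continuum.Support.NE7PairGlueStep
import Summits.QuantumFields.BalabanUV.T4Continuum.Support.BlockAverageLoopLog
import Literature.NumberTheory.LFunctions.PlateauMollifier
import HarnessLib

/-!
# NE7PairSymmetrise — HALVING THE PERIOD OF A GLUED PAIR GAUGE (F322): from a unitary, corner-pinned gauge `u`, `2Q`-periodic in direction `i`
# (`Q = N·M`, the data `U′, U_s` being `Q`-periodic), chart-close and with pair defect `≤ η`, the ANTISYMMETRIC GLUE `w = glue(ρ_i; u, u(· + Q e_i))`
# (`ρ_i(x) = r(x_i)`, `r(t + Q) = 1 − r(t)`) is `Q`-PERIODIC in direction `i`, keeps every other invariant (`τ ↦ 9τ`, `η ↦ 13η + 16τ∕M`), and keeps the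
# shift-invariances of `u` along vectors whose `i`-component is a multiple of `2Q`

Cell `pub-balaban`, sub-cell t4, lineage `b2b-balaban-t4-ne7-p1` (CRUX PROVER NE7 #1 = OWNER of row NE7), gen 94; memo
`t4/b2b-balaban-t4-ne7-p1-g94/PAIR-REP-ROAD.md` §7.  File 8 of the road to the PAIR RESIDUAL SUP-REPRESENTATIVE.  The gluing induction (F321) works with the doubled
period `2NM` (parities of blocks are only defined modulo an EVEN period); `d` applications of this file restore the data's period `NM`.  The profile is
`r(t) = clamp01(3∕2 − (2∕Q)|t mod 2Q − Q|)` (values in `[0,1]`, `2∕Q`-Lipschitz on `ℤ`, `r(t+Q) = 1 − r(t)`); the key identity is the SYMMETRY OF THE GEODESIC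
`geo (1−s) b a = geo s a b` for close unitaries, which makes the three-case glue of `(1 − ρ; v, u)` at `x + Qe_i` equal to that of `(ρ; u, v)` at `x`.
WHAT ([folklore]; 0 def, 0 sorry; any C⋆-algebra, any `d`): §1 `geo_symm`; §2 the profile (`exists_halfPeriodProfile`); §3 `symmetrise_step`.
HONEST FRAMING: bookkeeping over F315; nothing of Bałaban's asserted; hleaves NOT discharged; NE7 NOT PROVED; spine 0∕9; finite T⁴ rung (B)+1 — NOT infinite volume,
NOT mass gap, NOT `BetaPertH`, NOT Clay.  Axioms ⊆ {propext, Classical.choice, Quot.sound}.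
-/

set_option autoImplicit false

open NormedSpace
open scoped BigOperators

namespace Summit.QuantumFields.BalabanUV.T4Continuum.NE7PairSymmetrise

open Literature.MathematicalPhysics.QuantumFieldTheory.Balaban1983to89
open MatrixLog B7Prop1Explicit B7Prop2Explicit UnitaryRootInterpolation UnitaryGeodesic NE7PairGlueStep

noncomputable section

variable {𝔸 : Type*} [CStarAlgebra 𝔸] [Nontrivial 𝔸] {d : ℕ}

/-! ## §1 Symmetry of the geodesic -/

omit [Nontrivial 𝔸] in
/-- **SYMMETRY OF THE GEODESIC**: `geo (1 − s) b a = geo s a b` for unitary units with `‖b − a‖ ≤ 1∕4`. [folklore] -/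
theorem geo_symm {a b : 𝔸ˣ} (ha : a ∈ unitaryUnits 𝔸) (h : ‖(b : 𝔸) - a‖ ≤ 1 / 4) (s : ℝ) :
    geo (1 - s) b a = geo s a b := by
  letI : NormedAlgebra ℚ 𝔸 := NormedAlgebra.restrictScalars ℚ ℂ 𝔸
  set R : 𝔸ˣ := a⁻¹ * b with hR
  have hR1 : ‖(R : 𝔸) - 1‖ ≤ 1 / 4 := by rw [hR, norm_ratio_sub_one ha]; exact h
  have hR1' : ‖(R : 𝔸) - 1‖ < 1 := by linarith
  have hRinv : b⁻¹ * a = R⁻¹ := by rw [hR]; group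
  have hb' : (b : 𝔸) = (a : 𝔸) * (R : 𝔸) := by rw [hR, Units.val_mul, Units.mul_inv_cancel_left]
  apply Units.ext
  show (b : 𝔸) * upow (1 - s) ((b⁻¹ * a : 𝔸ˣ) : 𝔸) = (a : 𝔸) * upow s ((a⁻¹ * b : 𝔸ˣ) : 𝔸)
  rw [hRinv, ← hR, upow, upow, BlockAverageLoopLog.mlog_units_inv hR1, smul_neg, ← neg_smul, hb', mul_assoc]
  congr 1
  calc (R : 𝔸) * exp (-(1 - s) • mlog (R : 𝔸)) = exp ((1 : ℝ) • mlog (R : 𝔸)) * exp (-(1 - s) • mlog (R : 𝔸)) := by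
        rw [one_smul, exp_mlog hR1']
    _ = exp (((1 : ℝ) + -(1 - s)) • mlog (R : 𝔸)) := by rw [add_smul, exp_add_of_commute (commute_smul_mlog _ _ _)]
    _ = exp (s • mlog (R : 𝔸)) := by rw [show (1 : ℝ) + -(1 - s) = s by ring]

/-! ## §2 The half-period profile -/

/-- **THE HALF-PERIOD PROFILE**: for `Q ≥ 1` there is `r : ℤ → ℝ` with values in `[0,1]`, `r(t + Q) = 1 − r(t)`, `r(t + 2Q) = r(t)` and `|r(t+1) − r(t)| ≤ 2∕Q`. [folklore] -/
theorem exists_halfPeriodProfile {Q : ℕ} (hQ : 1 ≤ Q) :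
    ∃ r : ℤ → ℝ, (∀ t, 0 ≤ r t ∧ r t ≤ 1) ∧ (∀ t, r (t + Q) = 1 - r t) ∧ (∀ t, r (t + 2 * Q) = r t) ∧ (∀ t, |r (t + 1) - r t| ≤ 2 / (Q : ℝ)) := by
  have hQ0 : (0 : ℤ) < Q := by exact_mod_cast hQ
  have h2Q : (0 : ℤ) < 2 * (Q : ℤ) := by linarith
  have hQr : (0 : ℝ) < Q := by exact_mod_cast hQ
  have hQ1r : (1 : ℝ) ≤ Q := by exact_mod_cast hQ
  -- distance to the nearest odd multiple of `Q`
  let D : ℤ → ℝ := fun t => |((t % (2 * (Q : ℤ)) : ℤ) : ℝ) - Q|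
  let r : ℤ → ℝ := fun t => max 0 (min 1 (3 / 2 - 2 / (Q : ℝ) * D t))
  have hclamp : ∀ y : ℝ, 1 - max 0 (min 1 y) = max 0 (min 1 (1 - y)) := by
    intro y
    rcases le_total y 0 with hy | hy
    · rw [min_eq_right (by linarith : y ≤ 1), max_eq_left hy, min_eq_left (by linarith : (1 : ℝ) ≤ 1 - y), max_eq_right zero_le_one]; ring
    · rcases le_total y 1 with hy1 | hy1
      · rw [min_eq_right hy1, max_eq_right hy, min_eq_right (by linarith : 1 - y ≤ 1), max_eq_right (by linarith)]
      · rw [min_eq_left hy1, max_eq_right zero_le_one, min_eq_right (by linarith : 1 - y ≤ 1), max_eq_left (by linarith)]; ring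
  -- `t mod 2Q` and `(t + Q) mod 2Q` are `Q` apart inside `[0, 2Q)`, so the two distances add up to `Q`
  have hmod : ∀ t : ℤ, 0 ≤ t % (2 * (Q : ℤ)) ∧ t % (2 * (Q : ℤ)) < 2 * Q := fun t => ⟨Int.emod_nonneg _ h2Q.ne', Int.emod_lt_of_pos _ h2Q⟩
  have hshift : ∀ t : ℤ, (t + Q) % (2 * (Q : ℤ)) = t % (2 * (Q : ℤ)) + Q ∨ (t + Q) % (2 * (Q : ℤ)) = t % (2 * (Q : ℤ)) - Q := by
    intro t
    have h1 := Int.emod_add_mul_ediv t (2 * (Q : ℤ))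
    have h2 := Int.emod_add_mul_ediv (t + Q) (2 * (Q : ℤ))
    obtain ⟨ha, hb⟩ := hmod t
    obtain ⟨hc, hd⟩ := hmod (t + Q)
    -- the difference of the two remainders is `Q` modulo `2Q` and lies in `(−2Q, 2Q)`
    have hdiv : ∃ k : ℤ, (t + Q) % (2 * (Q : ℤ)) - t % (2 * (Q : ℤ)) - Q = 2 * (Q : ℤ) * k :=
      ⟨t / (2 * (Q : ℤ)) - (t + Q) / (2 * (Q : ℤ)), by linarith⟩
    obtain ⟨k, hk⟩ := hdiv
    have hk1 : k < 1 := by by_contra h; push Not at h; nlinarith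
    have hk2 : -2 < k := by by_contra h; push Not at h; nlinarith
    interval_cases k
    · right; linarith
    · left; linarith
  have hD_shift : ∀ t : ℤ, D (t + Q) = (Q : ℝ) - D t := by
    intro t
    obtain ⟨ha, hb⟩ := hmod t
    have ha' : (0 : ℝ) ≤ ((t % (2 * (Q : ℤ)) : ℤ) : ℝ) := by exact_mod_cast ha
    have hb' : (((t % (2 * (Q : ℤ))) : ℤ) : ℝ) < 2 * Q := by exact_mod_cast hb
    simp only [D]
    rcases hshift t with h | h
    · rw [h]; push_cast
      rw [add_sub_cancel_right, abs_of_nonneg ha']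
      have : (((t % (2 * (Q : ℤ))) : ℤ) : ℝ) - Q ≤ 0 := by
        -- in this branch `t mod 2Q + Q < 2Q`
        have hc := (hmod (t + Q)).2; rw [h] at hc
        have : (((t % (2 * (Q : ℤ))) : ℤ) : ℝ) + Q < 2 * Q := by exact_mod_cast hc
        linarith
      rw [abs_of_nonpos this]; ring
    · rw [h]; push_cast
      have hge : (Q : ℝ) ≤ (((t % (2 * (Q : ℤ))) : ℤ) : ℝ) := by
        have hc := (hmod (t + Q)).1; rw [h] at hc
        have : (0 : ℝ) ≤ (((t % (2 * (Q : ℤ))) : ℤ) : ℝ) - Q := by exact_mod_cast hc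
        linarith
      rw [abs_of_nonneg (by linarith : (0 : ℝ) ≤ (((t % (2 * (Q : ℤ))) : ℤ) : ℝ) - Q),
        show (((t % (2 * (Q : ℤ))) : ℤ) : ℝ) - Q - Q = -(2 * Q - (((t % (2 * (Q : ℤ))) : ℤ) : ℝ)) by ring, abs_neg,
        abs_of_nonneg (by linarith)]
      ring
  have hD_lip : ∀ t : ℤ, |D (t + 1) - D t| ≤ 1 := by
    intro t
    obtain ⟨ha, hb⟩ := hmod t
    have hstep : (t + 1) % (2 * (Q : ℤ)) = t % (2 * (Q : ℤ)) + 1 ∨ ((t + 1) % (2 * (Q : ℤ)) = 0 ∧ t % (2 * (Q : ℤ)) = 2 * Q - 1) := by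
      have h1 := Int.emod_add_mul_ediv t (2 * (Q : ℤ))
      have h2 := Int.emod_add_mul_ediv (t + 1) (2 * (Q : ℤ))
      obtain ⟨hc, hd⟩ := hmod (t + 1)
      have hdiv : ∃ k : ℤ, (t + 1) % (2 * (Q : ℤ)) - t % (2 * (Q : ℤ)) - 1 = 2 * (Q : ℤ) * k :=
        ⟨t / (2 * (Q : ℤ)) - (t + 1) / (2 * (Q : ℤ)), by linarith⟩
      obtain ⟨k, hk⟩ := hdiv
      have hk1 : k < 1 := by by_contra h; push Not at h; nlinarith
      have hk2 : -2 < k := by by_contra h; push Not at h; nlinarith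
      interval_cases k
      · right; constructor <;> nlinarith
      · left; linarith
    simp only [D]
    rcases hstep with h | ⟨h0, h1⟩
    · rw [h]; push_cast
      refine (abs_abs_sub_abs_le _ _).trans ?_
      rw [show (((t % (2 * (Q : ℤ))) : ℤ) : ℝ) + 1 - Q - ((((t % (2 * (Q : ℤ))) : ℤ) : ℝ) - Q) = 1 by ring]; simp
    · rw [h0, h1]; push_cast
      rw [show ((0 : ℝ) - Q) = -Q by ring, abs_neg, abs_of_nonneg hQr.le,
        show (2 * (Q : ℝ) - 1 - Q) = Q - 1 by ring, abs_of_nonneg (by linarith : (0 : ℝ) ≤ (Q : ℝ) - 1)]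
      rw [show (Q : ℝ) - (Q - 1) = 1 by ring]; simp
  refine ⟨r, fun t => ⟨le_max_left _ _, max_le zero_le_one (min_le_left _ _)⟩, fun t => ?_, fun t => ?_, fun t => ?_⟩
  · -- antisymmetry
    show max 0 (min 1 (3 / 2 - 2 / (Q : ℝ) * D (t + Q))) = 1 - max 0 (min 1 (3 / 2 - 2 / (Q : ℝ) * D t))
    rw [hclamp, hD_shift]
    congr 2; field_simp; ring
  · -- `2Q`-periodicity
    show max 0 (min 1 (3 / 2 - 2 / (Q : ℝ) * D (t + 2 * Q))) = max 0 (min 1 (3 / 2 - 2 / (Q : ℝ) * D t))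
    have hmod2 : (t + 2 * (Q : ℤ)) % (2 * (Q : ℤ)) = t % (2 * (Q : ℤ)) := by
      rw [show t + 2 * (Q : ℤ) = t + (2 * (Q : ℤ)) * 1 by ring, Int.add_mul_emod_self_left]
    have : D (t + 2 * Q) = D t := by simp only [D, hmod2]
    rw [this]
  · -- Lipschitz
    show |max 0 (min 1 (3 / 2 - 2 / (Q : ℝ) * D (t + 1))) - max 0 (min 1 (3 / 2 - 2 / (Q : ℝ) * D t))| ≤ 2 / Q
    refine (Literature.NumberTheory.LFunctions.PlateauMollifier.abs_clamp_sub_clamp_le _ _).trans ?_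
    rw [show (3 / 2 - 2 / (Q : ℝ) * D (t + 1)) - (3 / 2 - 2 / (Q : ℝ) * D t) = -(2 / (Q : ℝ)) * (D (t + 1) - D t) by ring, abs_mul, abs_neg,
      abs_of_pos (by positivity : (0 : ℝ) < 2 / Q)]
    calc 2 / (Q : ℝ) * |D (t + 1) - D t| ≤ 2 / (Q : ℝ) * 1 := mul_le_mul_of_nonneg_left (hD_lip t) (by positivity)
      _ = 2 / Q := mul_one _

/-! ## §3 The symmetrisation step -/

/-- **THE SYMMETRISATION STEP** (see the file header): direction `i`, half period `Q = N·M`. [folklore] -/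
theorem symmetrise_step {Us U' : Site d → Fin d → 𝔸ˣ} (hUs : ∀ x μ, Us x μ ∈ unitaryUnits 𝔸) (hU' : ∀ x μ, U' x μ ∈ unitaryUnits 𝔸)
    {M N : ℕ} (hM : 1 ≤ M) (hN : 1 ≤ N) (i : Fin d)
    (hUsP : ∀ x μ, Us (x + ((N * M : ℕ) : ℤ) • e i) μ = Us x μ) (hU'P : ∀ x μ, U' (x + ((N * M : ℕ) : ℤ) • e i) μ = U' x μ)
    {g : Site d → Site d → 𝔸ˣ}
    (hgeq : ∀ (ζ x : Site d) (j : Fin d), g (ζ + (N : ℤ) • e j) (x + ((N * M : ℕ) : ℤ) • e j) = g ζ x)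
    {u : Site d → 𝔸ˣ} {τ η : ℝ} (hη0 : 0 ≤ η) (hτ : 2 * τ ≤ 1 / 4)
    (huU : ∀ x, u x ∈ unitaryUnits 𝔸) (hupin : ∀ ζ : Site d, u ((M : ℤ) • ζ) = 1)
    (huper : ∀ x : Site d, u (x + ((2 * N * M : ℕ) : ℤ) • e i) = u x)
    (husite : ∀ x (ζ : Site d), (∀ j, |x j - (M : ℤ) * ζ j| ≤ (M : ℤ)) → ‖((u x : 𝔸ˣ) : 𝔸) - ((g ζ x : 𝔸ˣ) : 𝔸)‖ ≤ τ)
    (hubond : ∀ (x : Site d) (μ : Fin d), ‖(((Us x μ)⁻¹ * gaugeAct u U' x μ : 𝔸ˣ) : 𝔸) - 1‖ ≤ η) :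
    ∃ w : Site d → 𝔸ˣ,
      (∀ x, w x ∈ unitaryUnits 𝔸) ∧ (∀ ζ : Site d, w ((M : ℤ) • ζ) = 1) ∧
      (∀ x : Site d, w (x + ((N * M : ℕ) : ℤ) • e i) = w x) ∧
      (∀ s : Site d, (2 * ((N * M : ℕ) : ℤ)) ∣ s i → (∀ x, u (x + s) = u x) → ∀ x, w (x + s) = w x) ∧
      (∀ x (ζ : Site d), (∀ j, |x j - (M : ℤ) * ζ j| ≤ (M : ℤ)) → ‖((w x : 𝔸ˣ) : 𝔸) - ((g ζ x : 𝔸ˣ) : 𝔸)‖ ≤ 9 * τ) ∧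
      (∀ (x : Site d) (μ : Fin d), ‖(((Us x μ)⁻¹ * gaugeAct w U' x μ : 𝔸ˣ) : 𝔸) - 1‖ ≤ 13 * η + 16 * τ / (M : ℝ)) := by
  classical
  have hQ : 1 ≤ N * M := Nat.one_le_iff_ne_zero.mpr (Nat.mul_ne_zero (by omega) (by omega))
  have hM0 : (0 : ℝ) < M := by exact_mod_cast (by omega : 0 < M)
  have hQM : (M : ℝ) ≤ ((N * M : ℕ) : ℝ) := by
    have : (1 : ℝ) ≤ N := by exact_mod_cast hN
    push_cast; nlinarith
  obtain ⟨r, hr01, hrQ, hr2Q, hrlip⟩ := exists_halfPeriodProfile hQ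
  set sQ : Site d := ((N * M : ℕ) : ℤ) • e i with hsQ
  -- the patch, the weight, the glued gauge
  let v : Site d → 𝔸ˣ := fun x => u (x + sQ)
  let φ : Site d → ℝ := fun x => r (x i)
  let w : Site d → 𝔸ˣ := fun x => if φ x ≤ 0 then u x else if 1 ≤ φ x then v x else geo (φ x) (u x) (v x)
  have hφ01 : ∀ x, 0 ≤ φ x ∧ φ x ≤ 1 := fun x => hr01 _
  have hw0 : ∀ x, φ x ≤ 0 → w x = u x := fun x h => by simp only [w, if_pos h]
  have hw1 : ∀ x, 1 ≤ φ x → w x = v x := fun x h => by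
    have h' : ¬ φ x ≤ 0 := by linarith
    simp only [w, if_neg h', if_pos h]
  have hwm : ∀ x, 0 < φ x → φ x < 1 → w x = geo (φ x) (u x) (v x) := fun x h0 h1 => by
    have h' : ¬ φ x ≤ 0 := by linarith
    have h'' : ¬ 1 ≤ φ x := by linarith
    simp only [w, if_neg h', if_neg h'']
  have hvU : ∀ x, v x ∈ unitaryUnits 𝔸 := fun x => huU _
  -- every site lies in the cube of its floor block, so `u` and its translate are `2τ`-close everywhere
  have hfloor : ∀ x : Site d, ∀ j, |x j - (M : ℤ) * (x j / (M : ℤ))| ≤ (M : ℤ) := by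
    intro x j
    have hM' : (0 : ℤ) < M := by exact_mod_cast (by omega : 0 < M)
    have h1 := Int.emod_add_mul_ediv (x j) (M : ℤ)
    have h2 := Int.emod_nonneg (x j) hM'.ne'
    have h3 := Int.emod_lt_of_pos (x j) hM'
    rw [abs_le]; constructor <;> linarith
  have hτx : ∀ x, ‖((v x : 𝔸ˣ) : 𝔸) - ((u x : 𝔸ˣ) : 𝔸)‖ ≤ 2 * τ := by
    intro x
    let ζ : Site d := fun j => x j / (M : ℤ)
    have h1 : ‖((u x : 𝔸ˣ) : 𝔸) - ((g ζ x : 𝔸ˣ) : 𝔸)‖ ≤ τ := husite x ζ (hfloor x)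
    have h2 : ‖((u (x + sQ) : 𝔸ˣ) : 𝔸) - ((g (ζ + (N : ℤ) • e i) (x + sQ) : 𝔸ˣ) : 𝔸)‖ ≤ τ := by
      refine husite (x + sQ) (ζ + (N : ℤ) • e i) (fun j => ?_)
      simp only [hsQ, Pi.add_apply, Pi.smul_apply, e_apply, smul_eq_mul]
      split_ifs
      · push_cast; rw [show x j + (N : ℤ) * M * 1 - (M : ℤ) * (ζ j + (N : ℤ) * 1) = x j - (M : ℤ) * ζ j by ring]; exact hfloor x j
      · simp only [mul_zero, add_zero]; exact hfloor x j
    rw [hgeq ζ x i] at h2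
    calc ‖((v x : 𝔸ˣ) : 𝔸) - ((u x : 𝔸ˣ) : 𝔸)‖
        = ‖(((u (x + sQ) : 𝔸ˣ) : 𝔸) - ((g ζ x : 𝔸ˣ) : 𝔸)) + (((g ζ x : 𝔸ˣ) : 𝔸) - ((u x : 𝔸ˣ) : 𝔸))‖ := by rw [sub_add_sub_cancel]
      _ ≤ τ + τ := (norm_add_le _ _).trans (add_le_add h2 (by rw [norm_sub_rev]; exact h1))
      _ = 2 * τ := by ring
  have hτx' : ∀ x, ‖((v x : 𝔸ˣ) : 𝔸) - ((u x : 𝔸ˣ) : 𝔸)‖ ≤ 1 / 4 := fun x => (hτx x).trans hτ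
  have hwU : ∀ x, w x ∈ unitaryUnits 𝔸 := fun x => glue_mem_unitaryUnits_at hw0 hw1 hwm huU hvU (fun _ => hτx' x)
  -- the patch has the same pair defect (data periodicity)
  have herr_v : ∀ (x : Site d) (μ : Fin d), ‖(((Us x μ)⁻¹ * gaugeAct v U' x μ : 𝔸ˣ) : 𝔸) - 1‖ ≤ η := by
    intro x μ
    have h1 : gaugeAct v U' x μ = gaugeAct u U' (x + sQ) μ := by
      show u (x + sQ) * U' x μ * (u (x + e μ + sQ))⁻¹ = u (x + sQ) * U' (x + sQ) μ * (u (x + sQ + e μ))⁻¹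
      rw [hsQ, hU'P, add_right_comm x (e μ)]
    have h2 : Us x μ = Us (x + sQ) μ := by rw [hsQ, hUsP]
    rw [h1, h2]; exact hubond _ _
  refine ⟨w, hwU, fun ζ => ?_, fun x => ?_, fun s hs hus x => ?_, fun x ζ hζ => ?_, fun x μ => ?_⟩
  · -- pinning: both parties are `1` at the corners
    have huv : u ((M : ℤ) • ζ) = v ((M : ℤ) • ζ) := by
      show u ((M : ℤ) • ζ) = u ((M : ℤ) • ζ + sQ)
      have : (M : ℤ) • ζ + sQ = (M : ℤ) • (ζ + (N : ℤ) • e i) := by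
        rw [hsQ, smul_add, smul_smul]; push_cast; ring_nf
      rw [this, hupin, hupin]
    rw [glue_eq_of_eq hw0 hw1 hwm huv, hupin]
  · -- THE HALF PERIOD: the glue at `x + Q e_i` is the glue of `(1 − ρ; v, u)` at `x`
    have hφs : φ (x + sQ) = 1 - φ x := by
      show r ((x + sQ) i) = 1 - r (x i)
      simp only [hsQ, Pi.add_apply, Pi.smul_apply, e_apply, if_true, smul_eq_mul, mul_one]
      exact hrQ (x i)
    have hvs : v (x + sQ) = u x := by
      show u (x + sQ + sQ) = u x
      rw [add_assoc, hsQ, ← add_smul, show ((N * M : ℕ) : ℤ) + ((N * M : ℕ) : ℤ) = ((2 * N * M : ℕ) : ℤ) by push_cast; ring]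
      exact huper x
    show (if φ (x + sQ) ≤ 0 then u (x + sQ) else if 1 ≤ φ (x + sQ) then v (x + sQ) else geo (φ (x + sQ)) (u (x + sQ)) (v (x + sQ)))
      = (if φ x ≤ 0 then u x else if 1 ≤ φ x then v x else geo (φ x) (u x) (v x))
    rw [hφs, hvs]
    rcases lt_or_ge 0 (φ x) with h0 | h0
    · rcases lt_or_ge (φ x) 1 with h1 | h1
      · have ha : ¬ (1 - φ x ≤ 0) := by linarith
        have hb : ¬ (1 ≤ 1 - φ x) := by linarith
        have hc : ¬ (φ x ≤ 0) := by linarith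
        have hd : ¬ (1 ≤ φ x) := by linarith
        rw [if_neg ha, if_neg hb, if_neg hc, if_neg hd]
        exact geo_symm (huU x) (hτx' x) (φ x)
      · have hφ1 : φ x = 1 := le_antisymm (hφ01 x).2 h1
        rw [hφ1, if_pos (by norm_num : (1 : ℝ) - 1 ≤ 0), if_neg (by norm_num : ¬ ((1 : ℝ) ≤ 0)), if_pos le_rfl]
    · have hφ0 : φ x = 0 := le_antisymm h0 (hφ01 x).1
      rw [hφ0, if_neg (by norm_num : ¬ ((1 : ℝ) - 0 ≤ 0)), if_pos (by norm_num : (1 : ℝ) ≤ 1 - 0), if_pos le_rfl]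
  · -- inherited shift-invariance
    have hφs : ∀ y, φ (y + s) = φ y := by
      intro y
      obtain ⟨k, hk⟩ := hs
      have hper : Function.Periodic r (2 * ((N * M : ℕ) : ℤ)) := fun t => hr2Q t
      show r ((y + s) i) = r (y i)
      rw [Pi.add_apply, hk, show y i + 2 * ((N * M : ℕ) : ℤ) * k = y i + k * (2 * ((N * M : ℕ) : ℤ)) by ring]
      exact (hper.int_mul k) (y i)
    have hvs' : ∀ y, v (y + s) = v y := fun y => by show u (y + s + sQ) = u (y + sQ); rw [add_right_comm, hus]
    exact glue_shift hw0 hw1 hwm hφs hus hvs' x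
  · -- site closeness: through the patch
    have h1 : ‖((w x : 𝔸ˣ) : 𝔸) - ((v x : 𝔸ˣ) : 𝔸)‖ ≤ 4 * (1 - φ x) * ‖((v x : 𝔸ˣ) : 𝔸) - ((u x : 𝔸ˣ) : 𝔸)‖ :=
      norm_glue_sub_right_le hφ01 hw0 hw1 hwm huU hvU (fun _ => hτx' x)
    have h2 : ‖((v x : 𝔸ˣ) : 𝔸) - ((g ζ x : 𝔸ˣ) : 𝔸)‖ ≤ τ := by
      have h := husite (x + sQ) (ζ + (N : ℤ) • e i) (fun j => by
        simp only [hsQ, Pi.add_apply, Pi.smul_apply, e_apply, smul_eq_mul]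
        split_ifs
        · push_cast; rw [show x j + (N : ℤ) * M * 1 - (M : ℤ) * (ζ j + (N : ℤ) * 1) = x j - (M : ℤ) * ζ j by ring]; exact hζ j
        · simp only [mul_zero, add_zero]; exact hζ j)
      rwa [hgeq ζ x i] at h
    have h3 : 4 * (1 - φ x) * ‖((v x : 𝔸ˣ) : 𝔸) - ((u x : 𝔸ˣ) : 𝔸)‖ ≤ 8 * τ := by
      have := (hφ01 x).1; have := (hφ01 x).2
      nlinarith [hτx x, norm_nonneg (((v x : 𝔸ˣ) : 𝔸) - ((u x : 𝔸ˣ) : 𝔸))]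
    calc ‖((w x : 𝔸ˣ) : 𝔸) - ((g ζ x : 𝔸ˣ) : 𝔸)‖
        = ‖(((w x : 𝔸ˣ) : 𝔸) - ((v x : 𝔸ˣ) : 𝔸)) + (((v x : 𝔸ˣ) : 𝔸) - ((g ζ x : 𝔸ˣ) : 𝔸))‖ := by rw [sub_add_sub_cancel]
      _ ≤ _ := norm_add_le _ _
      _ ≤ 9 * τ := by linarith
  · -- bond defect: the fine letter everywhere
    have hfine := glue_err_fine (Us := Us) (U' := U') hUs hU' hφ01 hw0 hw1 hwm huU hvU x μ (hτx' x) (hτx' (x + e μ))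
    have hlip : |φ x - φ (x + e μ)| ≤ 2 / (M : ℝ) := by
      show |r (x i) - r ((x + e μ) i)| ≤ 2 / M
      simp only [Pi.add_apply, e_apply]
      split_ifs
      · rw [abs_sub_comm]
        exact (hrlip (x i)).trans (div_le_div_of_nonneg_left (by norm_num) hM0 hQM)
      · rw [add_zero, sub_self, abs_zero]; positivity
    have h1 : 6 * (1 - φ x) * (‖(((Us x μ)⁻¹ * gaugeAct u U' x μ : 𝔸ˣ) : 𝔸) - 1‖ + ‖(((Us x μ)⁻¹ * gaugeAct v U' x μ : 𝔸ˣ) : 𝔸) - 1‖)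
        ≤ 12 * η := by
      have ha : 0 ≤ 1 - φ x := by linarith [(hφ01 x).2]
      have hs : ‖(((Us x μ)⁻¹ * gaugeAct u U' x μ : 𝔸ˣ) : 𝔸) - 1‖ + ‖(((Us x μ)⁻¹ * gaugeAct v U' x μ : 𝔸ˣ) : 𝔸) - 1‖ ≤ 2 * η := by
        linarith [hubond x μ, herr_v x μ]
      have hs0 : 0 ≤ ‖(((Us x μ)⁻¹ * gaugeAct u U' x μ : 𝔸ˣ) : 𝔸) - 1‖ + ‖(((Us x μ)⁻¹ * gaugeAct v U' x μ : 𝔸ˣ) : 𝔸) - 1‖ := by positivity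
      nlinarith [(hφ01 x).1]
    have h2 : 4 * |φ x - φ (x + e μ)| * ‖((v (x + e μ) : 𝔸ˣ) : 𝔸) - ((u (x + e μ) : 𝔸ˣ) : 𝔸)‖ ≤ 16 * τ / (M : ℝ) := by
      have h4M : 0 ≤ 2 / (M : ℝ) := by positivity
      have := abs_nonneg (φ x - φ (x + e μ))
      have h16 : 4 * (2 / (M : ℝ)) * (2 * τ) = 16 * τ / (M : ℝ) := by ring
      rw [← h16]
      nlinarith [hτx (x + e μ), norm_nonneg (((v (x + e μ) : 𝔸ˣ) : 𝔸) - ((u (x + e μ) : 𝔸ˣ) : 𝔸))]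
    linarith [herr_v x μ]

end

end Summit.QuantumFields.BalabanUV.T4Continuum.NE7PairSymmetrise
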